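import Mathlib.Data.Nat.Choose.Basic
import Mathlib.Algebra.BigOperators.Intervals
import Mathlib.Algebra.Order.BigOperators.Group.Finset
import Mathlib.Tactic
import Summits.CriticalPhenomena.PercolationContinuityZ3.Theorems.PercNearOneGluingNoHeavyLowerTailPeakTilt
import Summits.CriticalPhenomena.PercolationContinuityZ3.Theorems.PercNearOneGluingNoHeavyLowerTailHypMoments
import HarnessLib

/-!
# The covariance bound of the CORE-LEMMA proof: steps (B1)×(B1), (B2) and the abstract two-block inequality

Support file for the Sahi / Conjecture-P programme of route `PercNearOneGluingNoHeavy`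
(`--supports stmt-CriticalPhenomena-4575`, prover prim-l12-p5 gen 27; proof notes
`prim-l12-p5/CORE-g26.md` §5.2–5.6 and `prim-l12-p5/PROOF-DF1-g26.md` §3.2–3.6).
No definitions, no named facts, no sorries.

Setting (note §5.2).  After the MASTER IDENTITY and the own-buffer split, the CORE LEMMA reads
`0 ≤ (n₁+n₂-1) · ∑_{k ≤ K} Mo₁(k) Mo₂(K-k) + M₁M₂ · ∑_{k ≤ K} F₁(k) F₂(K-k)` for two BLOCKS
(`CoreBlock`) of sizes `n₁ + n₂ = 2K`, where `F_b ≥ 0` is the block weight (symmetric about `n_b/2`,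
supported on `k ≤ n_b`) and `Mo_b` the block moment (odd, nonnegative above the centre and bounded
there by `(B1)`: `n_b Mo_b(k) ≤ (2k-n_b) M_b F_b(k)`), and `F_b` satisfies the EXTENDED-LEMMA-Φ step
inequality `(k+1)F_b(k+1) ≤ (n_b-k)F_b(k)` for `n_b ≤ 2k+1`.  This file proves that inequality from
exactly these abstract one-block properties (`core_abstract`); the instantiation with the explicit
block sums is done in the CORE-LEMMA file.  Steps:

* `psi_step`, `psi_chain`, `psi_symm`, `psi_anti`, `F_eq_choose_mul_psi` : the normalised weight
  `ψ_b(k) = F_b(k)/C(n_b,k)` is symmetric and peaked: `ψ_b(j) ≤ ψ_b(i)` whenever `(i-j)(i+j-n_b) ≤ 0`;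
* `second_moment_bound` (step (B2)) : `(n₁+n₂-1) ∑ (2k-n₁)² F₁(k)F₂(K-k) ≤ n₁n₂ ∑ F₁(k)F₂(K-k)`, by the
  weighted Chebyshev inequality `PeakTilt.tilted_moment_le` against the hypergeometric law
  `C(n₁,k)C(n₂,K-k)` and its second moment `HypMoments.hyp_second_moment`;
* `prod_bound` : termwise, `0 ≤ n₁n₂ Mo₁(k₁)Mo₂(k₂) + (2k₁-n₁)² M₁M₂ F₁(k₁)F₂(k₂)` for symmetric
  positions `2k₁+2k₂ = n₁+n₂` (oddness + sign + (B1) in each block);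
* `core_abstract` : the displayed inequality.
-/

namespace Summit.CriticalPhenomena.PercolationContinuityZ3.Theorems

namespace CoreCov

open Finset

/-! ### Peakedness of the normalised block weight `ψ(k) = F(k)/C(n,k)` -/

section Psi

variable (n : ℕ) (F : ℕ → ℝ)

/-- One step above the centre: `ψ(k+1) ≤ ψ(k)` for `n ≤ 2k+1`. -/
theorem psi_step (hF0 : ∀ k, 0 ≤ F k) (hFz : ∀ k, n < k → F k = 0)
    (hstep : ∀ k, n ≤ 2 * k + 1 → ((k : ℝ) + 1) * F (k + 1) ≤ ((n : ℝ) - k) * F k)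
    (k : ℕ) (hk : n ≤ 2 * k + 1) :
    F (k + 1) / (n.choose (k + 1) : ℝ) ≤ F k / (n.choose k : ℝ) := by
  rcases Nat.lt_or_ge k n with hkn | hkn
  · -- k + 1 ≤ n: cross-multiply, using (k+1) C(n,k+1) = (n-k) C(n,k)
    have hc1 : (0 : ℝ) < (n.choose (k + 1) : ℝ) := by exact_mod_cast Nat.choose_pos (by omega)
    have hc0 : (0 : ℝ) < (n.choose k : ℝ) := by exact_mod_cast Nat.choose_pos (by omega)
    rw [div_le_div_iff₀ hc1 hc0]
    have h := Nat.choose_succ_right_eq n k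
    have hc : ((n.choose (k + 1) * (k + 1) : ℕ) : ℝ) = ((n.choose k * (n - k) : ℕ) : ℝ) := by rw [h]
    push_cast [Nat.cast_sub hkn.le] at hc
    have hs := hstep k hk
    have key : ((k : ℝ) + 1) * (F (k + 1) * (n.choose k : ℝ)) ≤
        ((k : ℝ) + 1) * (F k * (n.choose (k + 1) : ℝ)) := by
      have e : ((k : ℝ) + 1) * (F k * (n.choose (k + 1) : ℝ)) =
          ((n : ℝ) - k) * F k * (n.choose k : ℝ) := by
        linear_combination F k * hc
      rw [e]
      have := mul_le_mul_of_nonneg_right hs hc0.le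
      linarith [this]
    exact le_of_mul_le_mul_left key (by positivity)
  · -- k ≥ n: F(k+1) = 0
    rw [hFz (k + 1) (by omega), zero_div]
    exact div_nonneg (hF0 k) (by positivity)

/-- Chain: `ψ` is nonincreasing on `{k : n ≤ 2k+1}`. -/
theorem psi_chain (hF0 : ∀ k, 0 ≤ F k) (hFz : ∀ k, n < k → F k = 0)
    (hstep : ∀ k, n ≤ 2 * k + 1 → ((k : ℝ) + 1) * F (k + 1) ≤ ((n : ℝ) - k) * F k)
    (i j : ℕ) (hi : n ≤ 2 * i + 1) (hij : i ≤ j) :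
    F j / (n.choose j : ℝ) ≤ F i / (n.choose i : ℝ) := by
  induction j, hij using Nat.le_induction with
  | base => exact le_rfl
  | succ j hij ih =>
    exact le_trans (psi_step n F hF0 hFz hstep j (by omega)) ih

/-- Symmetry of `ψ`. -/
theorem psi_symm (hFsym : ∀ k, k ≤ n → F (n - k) = F k) (k : ℕ) (hk : k ≤ n) :
    F (n - k) / (n.choose (n - k) : ℝ) = F k / (n.choose k : ℝ) := by
  rw [hFsym k hk, Nat.choose_symm hk]

/-- **Peakedness of `ψ` in closed form.**  If `(i-j)(i+j-n) ≤ 0` — equivalently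
`|2i-n| ≤ |2j-n|`, `i` at least as close to the centre as `j` — then `ψ(j) ≤ ψ(i)`. -/
theorem psi_anti (hF0 : ∀ k, 0 ≤ F k) (hFz : ∀ k, n < k → F k = 0)
    (hFsym : ∀ k, k ≤ n → F (n - k) = F k)
    (hstep : ∀ k, n ≤ 2 * k + 1 → ((k : ℝ) + 1) * F (k + 1) ≤ ((n : ℝ) - k) * F k)
    (i j : ℕ) (hij : ((i : ℝ) - j) * ((i : ℝ) + j - n) ≤ 0) :
    F j / (n.choose j : ℝ) ≤ F i / (n.choose i : ℝ) := by
  have hψ0 : ∀ k, 0 ≤ F k / (n.choose k : ℝ) := fun k => div_nonneg (hF0 k) (by positivity)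
  have hψz : ∀ k, n < k → F k / (n.choose k : ℝ) = 0 := fun k hk => by
    rw [hFz k hk, zero_div]
  rcases Nat.lt_or_ge j i with hji | hij'
  · -- j < i: then i + j ≤ n
    have hsum : i + j ≤ n := by
      by_contra hc
      have h1 : (0 : ℝ) < (i : ℝ) - j := by
        have : (j : ℝ) < i := by exact_mod_cast hji
        linarith
      have h2 : (0 : ℝ) < (i : ℝ) + j - n := by
        have : (n : ℝ) < (i : ℝ) + j := by exact_mod_cast (by omega : n < i + j)
        linarith
      nlinarith [mul_pos h1 h2]
    -- reflect j to j' = n - j ≥ i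
    rw [← psi_symm n F hFsym j (by omega)]
    rcases le_or_gt n (2 * i + 1) with hi | hi
    · exact psi_chain n F hF0 hFz hstep i (n - j) hi (by omega)
    · -- reflect i as well
      rw [← psi_symm n F hFsym i (by omega)]
      exact psi_chain n F hF0 hFz hstep (n - i) (n - j) (by omega) (by omega)
  · rcases eq_or_lt_of_le hij' with heq | hlt
    · rw [heq]
    · -- i < j: then n ≤ i + j
      have hsum : n ≤ i + j := by
        by_contra hc
        have h1 : (i : ℝ) - j < 0 := by
          have : (i : ℝ) < j := by exact_mod_cast hlt
          linarith
        have h2 : (i : ℝ) + j - n < 0 := by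
          have : (i : ℝ) + j < n := by exact_mod_cast (by omega : i + j < n)
          linarith
        nlinarith [mul_pos_of_neg_of_neg h1 h2]
      rcases Nat.lt_or_ge n j with hjn | hjn
      · rw [hψz j hjn]
        exact hψ0 i
      · rcases le_or_gt n (2 * i + 1) with hi | hi
        · exact psi_chain n F hF0 hFz hstep i j hi hlt.le
        · rw [← psi_symm n F hFsym i (by omega)]
          exact psi_chain n F hF0 hFz hstep (n - i) j (by omega) (by omega)

/-- `F(k) = C(n,k) · ψ(k)` for every `k` (both sides vanish above `n`). -/
theorem F_eq_choose_mul_psi (hFz : ∀ k, n < k → F k = 0) (k : ℕ) :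
    F k = (n.choose k : ℝ) * (F k / (n.choose k : ℝ)) := by
  rcases Nat.lt_or_ge n k with hk | hk
  · rw [hFz k hk]
    simp
  · have hc : (n.choose k : ℝ) ≠ 0 := by exact_mod_cast (Nat.choose_pos hk).ne'
    rw [mul_div_cancel₀ _ hc]

end Psi

/-! ### Step (B2): the second moment of the tilted weight `ν = F₁(k) F₂(K-k)` -/

/-- **Step (B2) of the note.**  Two blocks of sizes `n₁, n₂ ≥ 1` with `n₁ + n₂ = 2K`, block
weights `F_b ≥ 0` vanishing above `n_b`, symmetric, and satisfying the EXTENDED-LEMMA-Φ step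
inequality `(k+1) F_b(k+1) ≤ (n_b-k) F_b(k)` above the centre.  Then the weight
`ν(k) = F₁(k) F₂(K-k)` on `k ≤ K` has `(n₁+n₂-1) · ∑ ν(k) (2k-n₁)² ≤ n₁ n₂ · ∑ ν(k)`:
its second moment about the centre is at most that of `Hyp(n₁+n₂; n₁; K)` (weighted Chebyshev,
`PeakTilt.tilted_moment_le`, against `hyp_second_moment`). -/
theorem second_moment_bound (n₁ n₂ K : ℕ) (hN : n₁ + n₂ = 2 * K) (hn₁ : 1 ≤ n₁)
    (F₁ F₂ : ℕ → ℝ)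
    (hF₁0 : ∀ k, 0 ≤ F₁ k) (hF₁z : ∀ k, n₁ < k → F₁ k = 0) (hF₁sym : ∀ k, k ≤ n₁ → F₁ (n₁ - k) = F₁ k)
    (hF₁step : ∀ k, n₁ ≤ 2 * k + 1 → ((k : ℝ) + 1) * F₁ (k + 1) ≤ ((n₁ : ℝ) - k) * F₁ k)
    (hF₂0 : ∀ k, 0 ≤ F₂ k) (hF₂z : ∀ k, n₂ < k → F₂ k = 0) (hF₂sym : ∀ k, k ≤ n₂ → F₂ (n₂ - k) = F₂ k)
    (hF₂step : ∀ k, n₂ ≤ 2 * k + 1 → ((k : ℝ) + 1) * F₂ (k + 1) ≤ ((n₂ : ℝ) - k) * F₂ k) :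
    ((n₁ : ℝ) + n₂ - 1) * ∑ k ∈ range (K + 1), (2 * (k : ℝ) - n₁) ^ 2 * (F₁ k * F₂ (K - k)) ≤
      (n₁ : ℝ) * n₂ * ∑ k ∈ range (K + 1), F₁ k * F₂ (K - k) := by
  have hvar := HypMoments.hyp_second_moment n₁ n₂ K hN
  -- ν₀, Ψ, φ
  set ν₀ : ℕ → ℝ := fun k => (n₁.choose k : ℝ) * (n₂.choose (K - k) : ℝ) with hν₀
  set Ψ : ℕ → ℝ := fun k => (F₁ k / (n₁.choose k : ℝ)) * (F₂ (K - k) / (n₂.choose (K - k) : ℝ))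
    with hΨ
  set φ : ℕ → ℝ := fun k => (2 * (k : ℝ) - n₁) ^ 2 with hφ
  have hνΨ : ∀ k, F₁ k * F₂ (K - k) = ν₀ k * Ψ k := by
    intro k
    rw [F_eq_choose_mul_psi n₁ F₁ hF₁z k, F_eq_choose_mul_psi n₂ F₂ hF₂z (K - k)]
    simp only [hν₀, hΨ]
    ring
  have hsum1 : ∑ k ∈ range (K + 1), (2 * (k : ℝ) - n₁) ^ 2 * (F₁ k * F₂ (K - k)) =
      ∑ k ∈ range (K + 1), ν₀ k * (φ k * Ψ k) := by
    refine sum_congr rfl fun k _ => ?_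
    rw [hνΨ k]
    simp only [hφ]
    ring
  have hsum2 : ∑ k ∈ range (K + 1), F₁ k * F₂ (K - k) = ∑ k ∈ range (K + 1), ν₀ k * Ψ k :=
    sum_congr rfl fun k _ => hνΨ k
  have hsum3 : ∑ k ∈ range (K + 1), (n₁.choose k : ℝ) * (n₂.choose (K - k) : ℝ) *
      (2 * (k : ℝ) - n₁) ^ 2 = ∑ k ∈ range (K + 1), ν₀ k * φ k :=
    sum_congr rfl fun k _ => by simp only [hν₀, hφ]
  have hsum4 : ∑ k ∈ range (K + 1), (n₁.choose k : ℝ) * (n₂.choose (K - k) : ℝ) =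
      ∑ k ∈ range (K + 1), ν₀ k := sum_congr rfl fun k _ => by simp only [hν₀]
  rw [hsum1, hsum2]
  rw [hsum3, hsum4] at hvar
  -- weighted Chebyshev
  have hν : ∀ i ∈ range (K + 1), 0 ≤ ν₀ i := fun i _ => by
    simp only [hν₀]
    positivity
  have hmono : ∀ i ∈ range (K + 1), ∀ j ∈ range (K + 1), φ i ≤ φ j → Ψ j ≤ Ψ i := by
    intro i hi j hj hφij
    have hiK : i ≤ K := by
      have := mem_range.mp hi
      omega
    have hjK : j ≤ K := by
      have := mem_range.mp hj
      omega
    simp only [hφ] at hφij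
    have hprod : ((i : ℝ) - j) * ((i : ℝ) + j - n₁) ≤ 0 := by nlinarith [hφij]
    have h1 := psi_anti n₁ F₁ hF₁0 hF₁z hF₁sym hF₁step i j hprod
    have hprod2 : (((K - i : ℕ) : ℝ) - ((K - j : ℕ) : ℝ)) *
        (((K - i : ℕ) : ℝ) + ((K - j : ℕ) : ℝ) - n₂) ≤ 0 := by
      have hNr : (n₁ : ℝ) + n₂ = 2 * K := by exact_mod_cast hN
      push_cast [Nat.cast_sub hiK, Nat.cast_sub hjK]
      nlinarith [hprod, hNr]
    have h2 := psi_anti n₂ F₂ hF₂0 hF₂z hF₂sym hF₂step (K - i) (K - j) hprod2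
    simp only [hΨ]
    exact mul_le_mul h1 h2 (div_nonneg (hF₂0 _) (by positivity))
      (div_nonneg (hF₁0 _) (by positivity))
  have hcheb := PeakTilt.tilted_moment_le (range (K + 1)) ν₀ Ψ φ φ hν
    (fun i _ j _ h => h) hmono
  -- ∑ ν₀ > 0
  have hB : 0 < ∑ k ∈ range (K + 1), ν₀ k := by
    rw [← hsum4, HypMoments.vandermonde, hN]
    exact_mod_cast Nat.choose_pos (by omega)
  have hN1 : (0 : ℝ) ≤ (n₁ : ℝ) + n₂ - 1 := by
    have : (1 : ℝ) ≤ (n₁ : ℝ) := by exact_mod_cast hn₁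
    have : (0 : ℝ) ≤ (n₂ : ℝ) := by positivity
    linarith
  -- (N-1) A B ≤ (N-1) Cφ D = n₁ n₂ B D, then cancel B
  have key : (((n₁ : ℝ) + n₂ - 1) * ∑ k ∈ range (K + 1), ν₀ k * (φ k * Ψ k)) *
      (∑ k ∈ range (K + 1), ν₀ k) ≤
      ((n₁ : ℝ) * n₂ * ∑ k ∈ range (K + 1), ν₀ k * Ψ k) * (∑ k ∈ range (K + 1), ν₀ k) := by
    have := mul_le_mul_of_nonneg_left hcheb hN1
    calc (((n₁ : ℝ) + n₂ - 1) * ∑ k ∈ range (K + 1), ν₀ k * (φ k * Ψ k)) *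
          (∑ k ∈ range (K + 1), ν₀ k)
        = ((n₁ : ℝ) + n₂ - 1) * ((∑ k ∈ range (K + 1), ν₀ k * (φ k * Ψ k)) *
          (∑ k ∈ range (K + 1), ν₀ k)) := by ring
      _ ≤ ((n₁ : ℝ) + n₂ - 1) * ((∑ k ∈ range (K + 1), ν₀ k * φ k) *
          (∑ k ∈ range (K + 1), ν₀ k * Ψ k)) := this
      _ = (((n₁ : ℝ) + n₂ - 1) * (∑ k ∈ range (K + 1), ν₀ k * φ k)) *
          (∑ k ∈ range (K + 1), ν₀ k * Ψ k) := by ring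
      _ = ((n₁ : ℝ) * n₂ * ∑ k ∈ range (K + 1), ν₀ k) *
          (∑ k ∈ range (K + 1), ν₀ k * Ψ k) := by rw [hvar]
      _ = ((n₁ : ℝ) * n₂ * ∑ k ∈ range (K + 1), ν₀ k * Ψ k) * (∑ k ∈ range (K + 1), ν₀ k) := by
          ring
  exact le_of_mul_le_mul_right key hB

/-! ### The two-block product bound and the abstract CORE inequality -/

/-- Product bound, the case `n₁ ≤ 2k₁` (block 1 above its centre, block 2 below). -/
theorem prod_bound_aux (n₁ n₂ k₁ k₂ : ℕ) (Mc₁ Mc₂ : ℝ) (F₁ Mo₁ F₂ Mo₂ : ℕ → ℝ)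
    (hk₁ : n₁ ≤ 2 * k₁) (hk₂ : k₂ ≤ n₂) (hsum : 2 * k₁ + 2 * k₂ = n₁ + n₂)
    (hMo₁pos : ∀ k, n₁ ≤ 2 * k → 0 ≤ Mo₁ k)
    (hMo₁up : ∀ k, n₁ ≤ 2 * k → (n₁ : ℝ) * Mo₁ k ≤ (2 * (k : ℝ) - n₁) * Mc₁ * F₁ k)
    (hF₂sym : ∀ k, k ≤ n₂ → F₂ (n₂ - k) = F₂ k) (hMo₂odd : ∀ k, k ≤ n₂ → Mo₂ (n₂ - k) = -Mo₂ k)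
    (hMo₂pos : ∀ k, n₂ ≤ 2 * k → 0 ≤ Mo₂ k)
    (hMo₂up : ∀ k, n₂ ≤ 2 * k → (n₂ : ℝ) * Mo₂ k ≤ (2 * (k : ℝ) - n₂) * Mc₂ * F₂ k) :
    0 ≤ (n₁ : ℝ) * n₂ * (Mo₁ k₁ * Mo₂ k₂) +
      (2 * (k₁ : ℝ) - n₁) ^ 2 * (Mc₁ * Mc₂) * (F₁ k₁ * F₂ k₂) := by
  -- reflect block 2: k₂ = n₂ - k₂' with k₂' above the centre
  set k₂' := n₂ - k₂ with hk₂'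
  have hk₂'le : k₂' ≤ n₂ := by omega
  have ek₂ : k₂ = n₂ - k₂' := by omega
  have hk₂'c : n₂ ≤ 2 * k₂' := by omega
  have hMo : Mo₂ k₂ = -Mo₂ k₂' := by rw [ek₂, hMo₂odd k₂' hk₂'le]
  have hF : F₂ k₂ = F₂ k₂' := by rw [ek₂, hF₂sym k₂' hk₂'le]
  have hd : 2 * (k₂' : ℝ) - n₂ = 2 * (k₁ : ℝ) - n₁ := by
    have h1 : ((k₂' : ℕ) : ℝ) = (n₂ : ℝ) - k₂ := by
      rw [hk₂']
      push_cast [Nat.cast_sub hk₂]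
      ring
    have h2 : 2 * (k₁ : ℝ) + 2 * k₂ = (n₁ : ℝ) + n₂ := by exact_mod_cast hsum
    rw [h1]
    linarith
  have a0 := hMo₁pos k₁ hk₁
  have aA := hMo₁up k₁ hk₁
  have b0 := hMo₂pos k₂' hk₂'c
  have bB := hMo₂up k₂' hk₂'c
  rw [hd] at bB
  -- (n₁ Mo₁)(n₂ Mo₂') ≤ (d Mc₁ F₁)(d Mc₂ F₂')
  have hn₁ : (0 : ℝ) ≤ (n₁ : ℝ) := by positivity
  have hn₂ : (0 : ℝ) ≤ (n₂ : ℝ) := by positivity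
  have key : ((n₁ : ℝ) * Mo₁ k₁) * ((n₂ : ℝ) * Mo₂ k₂') ≤
      ((2 * (k₁ : ℝ) - n₁) * Mc₁ * F₁ k₁) * ((2 * (k₁ : ℝ) - n₁) * Mc₂ * F₂ k₂') :=
    mul_le_mul aA bB (mul_nonneg hn₂ b0) (le_trans (mul_nonneg hn₁ a0) aA)
  rw [hMo, hF]
  nlinarith [key]

/-- **Product bound.**  For two blocks with the one-block properties of `CoreBlock` (symmetry,
oddness, sign and upper bound (B1) above the centre) and head counts `k₁ ≤ n₁`, `k₂ ≤ n₂` placed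
symmetrically (`2k₁ + 2k₂ = n₁ + n₂`):
`0 ≤ n₁ n₂ · Mo₁(k₁) Mo₂(k₂) + (2k₁-n₁)² · Mc₁ Mc₂ · F₁(k₁) F₂(k₂)`. -/
theorem prod_bound (n₁ n₂ k₁ k₂ : ℕ) (Mc₁ Mc₂ : ℝ) (F₁ Mo₁ F₂ Mo₂ : ℕ → ℝ)
    (hk₁ : k₁ ≤ n₁) (hk₂ : k₂ ≤ n₂) (hsum : 2 * k₁ + 2 * k₂ = n₁ + n₂)
    (hF₁sym : ∀ k, k ≤ n₁ → F₁ (n₁ - k) = F₁ k) (hMo₁odd : ∀ k, k ≤ n₁ → Mo₁ (n₁ - k) = -Mo₁ k)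
    (hMo₁pos : ∀ k, n₁ ≤ 2 * k → 0 ≤ Mo₁ k)
    (hMo₁up : ∀ k, n₁ ≤ 2 * k → (n₁ : ℝ) * Mo₁ k ≤ (2 * (k : ℝ) - n₁) * Mc₁ * F₁ k)
    (hF₂sym : ∀ k, k ≤ n₂ → F₂ (n₂ - k) = F₂ k) (hMo₂odd : ∀ k, k ≤ n₂ → Mo₂ (n₂ - k) = -Mo₂ k)
    (hMo₂pos : ∀ k, n₂ ≤ 2 * k → 0 ≤ Mo₂ k)
    (hMo₂up : ∀ k, n₂ ≤ 2 * k → (n₂ : ℝ) * Mo₂ k ≤ (2 * (k : ℝ) - n₂) * Mc₂ * F₂ k) :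
    0 ≤ (n₁ : ℝ) * n₂ * (Mo₁ k₁ * Mo₂ k₂) +
      (2 * (k₁ : ℝ) - n₁) ^ 2 * (Mc₁ * Mc₂) * (F₁ k₁ * F₂ k₂) := by
  rcases le_or_gt n₁ (2 * k₁) with h | h
  · exact prod_bound_aux n₁ n₂ k₁ k₂ Mc₁ Mc₂ F₁ Mo₁ F₂ Mo₂ h hk₂ hsum hMo₁pos hMo₁up hF₂sym
      hMo₂odd hMo₂pos hMo₂up
  · -- swap the blocks
    have h' : n₂ ≤ 2 * k₂ := by omega
    have hswap := prod_bound_aux n₂ n₁ k₂ k₁ Mc₂ Mc₁ F₂ Mo₂ F₁ Mo₁ h' hk₁ (by omega) hMo₂pos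
      hMo₂up hF₁sym hMo₁odd hMo₁pos hMo₁up
    have hd : (2 * (k₂ : ℝ) - n₂) ^ 2 = (2 * (k₁ : ℝ) - n₁) ^ 2 := by
      have h2 : 2 * (k₁ : ℝ) + 2 * k₂ = (n₁ : ℝ) + n₂ := by exact_mod_cast hsum
      nlinarith [h2]
    rw [hd] at hswap
    nlinarith [hswap]

/-- **The abstract two-block CORE inequality (note §5.2, (5.3) ≥ 0).**  Two blocks of sizes
`n₁, n₂ ≥ 1`, `n₁ + n₂ = 2K`, with block weights `F_b` and block moments `Mo_b` having the one-block
properties (positivity, support, symmetry/oddness, sign and upper bound (B1) above the centre with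
scale constants `Mc_b ≥ 0`, and the EXTENDED-LEMMA-Φ step inequality), and the hypergeometric second
moment identity for `(n₁, n₂, K)`.  Then
`0 ≤ (n₁+n₂-1) · ∑_{k ≤ K} Mo₁(k) Mo₂(K-k) + Mc₁ Mc₂ · ∑_{k ≤ K} F₁(k) F₂(K-k)`. -/
theorem core_abstract (n₁ n₂ K : ℕ) (hN : n₁ + n₂ = 2 * K) (hn₁ : 1 ≤ n₁) (hn₂ : 1 ≤ n₂)
    (Mc₁ Mc₂ : ℝ) (hMc₁ : 0 ≤ Mc₁) (hMc₂ : 0 ≤ Mc₂) (F₁ Mo₁ F₂ Mo₂ : ℕ → ℝ)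
    (hF₁0 : ∀ k, 0 ≤ F₁ k) (hF₁z : ∀ k, n₁ < k → F₁ k = 0) (hF₁sym : ∀ k, k ≤ n₁ → F₁ (n₁ - k) = F₁ k)
    (hF₁step : ∀ k, n₁ ≤ 2 * k + 1 → ((k : ℝ) + 1) * F₁ (k + 1) ≤ ((n₁ : ℝ) - k) * F₁ k)
    (hMo₁z : ∀ k, n₁ < k → Mo₁ k = 0) (hMo₁odd : ∀ k, k ≤ n₁ → Mo₁ (n₁ - k) = -Mo₁ k)
    (hMo₁pos : ∀ k, n₁ ≤ 2 * k → 0 ≤ Mo₁ k)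
    (hMo₁up : ∀ k, n₁ ≤ 2 * k → (n₁ : ℝ) * Mo₁ k ≤ (2 * (k : ℝ) - n₁) * Mc₁ * F₁ k)
    (hF₂0 : ∀ k, 0 ≤ F₂ k) (hF₂z : ∀ k, n₂ < k → F₂ k = 0) (hF₂sym : ∀ k, k ≤ n₂ → F₂ (n₂ - k) = F₂ k)
    (hF₂step : ∀ k, n₂ ≤ 2 * k + 1 → ((k : ℝ) + 1) * F₂ (k + 1) ≤ ((n₂ : ℝ) - k) * F₂ k)
    (hMo₂z : ∀ k, n₂ < k → Mo₂ k = 0) (hMo₂odd : ∀ k, k ≤ n₂ → Mo₂ (n₂ - k) = -Mo₂ k)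
    (hMo₂pos : ∀ k, n₂ ≤ 2 * k → 0 ≤ Mo₂ k)
    (hMo₂up : ∀ k, n₂ ≤ 2 * k → (n₂ : ℝ) * Mo₂ k ≤ (2 * (k : ℝ) - n₂) * Mc₂ * F₂ k) :
    0 ≤ ((n₁ : ℝ) + n₂ - 1) * ∑ k ∈ range (K + 1), Mo₁ k * Mo₂ (K - k) +
      Mc₁ * Mc₂ * ∑ k ∈ range (K + 1), F₁ k * F₂ (K - k) := by
  -- termwise product bound
  have hterm : ∀ k ∈ range (K + 1), 0 ≤ (n₁ : ℝ) * n₂ * (Mo₁ k * Mo₂ (K - k)) +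
      (2 * (k : ℝ) - n₁) ^ 2 * (Mc₁ * Mc₂) * (F₁ k * F₂ (K - k)) := by
    intro k hk
    have hkK : k ≤ K := by
      have := mem_range.mp hk
      omega
    rcases Nat.lt_or_ge n₁ k with h1 | h1
    · rw [hMo₁z k h1, hF₁z k h1]
      simp
    rcases Nat.lt_or_ge n₂ (K - k) with h2 | h2
    · rw [hMo₂z (K - k) h2, hF₂z (K - k) h2]
      simp
    exact prod_bound n₁ n₂ k (K - k) Mc₁ Mc₂ F₁ Mo₁ F₂ Mo₂ h1 h2 (by omega) hF₁sym hMo₁odd hMo₁pos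
      hMo₁up hF₂sym hMo₂odd hMo₂pos hMo₂up
  have hS := sum_nonneg hterm
  rw [sum_add_distrib, ← mul_sum] at hS
  have hS' : 0 ≤ (n₁ : ℝ) * n₂ * ∑ k ∈ range (K + 1), Mo₁ k * Mo₂ (K - k) +
      Mc₁ * Mc₂ * ∑ k ∈ range (K + 1), (2 * (k : ℝ) - n₁) ^ 2 * (F₁ k * F₂ (K - k)) := by
    have e : ∑ k ∈ range (K + 1), (2 * (k : ℝ) - n₁) ^ 2 * (Mc₁ * Mc₂) * (F₁ k * F₂ (K - k)) =
        Mc₁ * Mc₂ * ∑ k ∈ range (K + 1), (2 * (k : ℝ) - n₁) ^ 2 * (F₁ k * F₂ (K - k)) := by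
      rw [mul_sum]
      refine sum_congr rfl fun k _ => ?_
      ring
    rw [e] at hS
    exact hS
  -- (B2)
  have hB2 := second_moment_bound n₁ n₂ K hN hn₁ F₁ F₂ hF₁0 hF₁z hF₁sym hF₁step hF₂0 hF₂z hF₂sym
    hF₂step
  have hMM : 0 ≤ Mc₁ * Mc₂ := mul_nonneg hMc₁ hMc₂
  have hnn : (0 : ℝ) < (n₁ : ℝ) * n₂ := by
    have : (1 : ℝ) ≤ n₁ := by exact_mod_cast hn₁
    have : (1 : ℝ) ≤ n₂ := by exact_mod_cast hn₂
    positivity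
  have hN1 : (0 : ℝ) ≤ (n₁ : ℝ) + n₂ - 1 := by
    have : (1 : ℝ) ≤ (n₁ : ℝ) := by exact_mod_cast hn₁
    have : (0 : ℝ) ≤ (n₂ : ℝ) := by positivity
    linarith
  -- n₁n₂ · [ (N-1) ΣMoMo + Mc ΣFF ] ≥ (N-1) n₁n₂ ΣMoMo + Mc (N-1) Σ φ FF ≥ 0
  have h3 : 0 ≤ (n₁ : ℝ) * n₂ * (((n₁ : ℝ) + n₂ - 1) * ∑ k ∈ range (K + 1), Mo₁ k * Mo₂ (K - k) +
      Mc₁ * Mc₂ * ∑ k ∈ range (K + 1), F₁ k * F₂ (K - k)) := by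
    have h4 := mul_le_mul_of_nonneg_left hB2 hMM
    have h5 := mul_nonneg hN1 hS'
    nlinarith [h4, h5]
  exact nonneg_of_mul_nonneg_right h3 hnn

end CoreCov

end Summit.CriticalPhenomena.PercolationContinuityZ3.Theorems
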